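import Summits.AtomisticToContinuum.FouriersLaw.Theses.OddSectorIrreversibility
import Summits.AtomisticToContinuum.FouriersLaw.Theorems.ClosedConeSensitivity.Negative.ZeroFrictionDictionary
import Summits.AtomisticToContinuum.FouriersLaw.Theorems.OddSectorIrreversibilityWitnessGlueClosedFlow
import Summits.AtomisticToContinuum.FouriersLaw.Theorems.OddSectorIrreversibilityWitnessGlueLeak
import Summits.AtomisticToContinuum.FouriersLaw.Theorems.OddSectorIrreversibilityCorrectorTheoryDetFlow

/-!
# `TapLeakBound` / Negative (1): dictionary and time parity of the tap-leak pairing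

Negative-side support for crux `stmt-AtomisticToContinuum-15159`
(`OddSectorIrreversibility.TapLeakBound`, "P", rank 4), from the standing disprover's work file
`Cruxes/TapLeakBound/Disproof.lean` §0–§1, all sorry-free, theorems only (no definitions: the
objects are spelled inline exactly as in the route decl — `u⁺ = fun x => (u x + u (x.1, -x.2)) / 2`,
the transported current `fun y => j_i (detFlow s y)`, the Gibbs weight `gibbsWeight`). Nothing here
closes the item and no Theses statement is asserted positively.

* DICTIONARY. `kernelCurrent_eq_comp_detFlow`: the kernel average
  `∫ j_i d(P₀.transitionKernel N T T s x)` of the crux IS `j_i (detFlow s x)` (zero friction ⇒ Dirac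
  mass at the closed flow), so the left-hand side of `P` is the `L²(e^{-H/T}dqdp)` pairing of
  `∂_{p_b}u⁺` with `∂_{p_b}(j_i ∘ Φ_s)`.
* PARITY (junk-free: a change of variables under the momentum reversal `Θ(q,p) = (q,-p)`, which
  preserves the Gibbs weight, plus `∂_{p_b}(g∘Θ) = -(∂_{p_b}g)∘Θ`; no regularity or integrability of
  `u`, `g` is used): `tapPairing_eq_tapPairing_flip` — the pairing only sees the Θ-even part of the
  transported observable; `tapPairing_eq_zero_of_odd` — it vanishes against every Θ-odd observable, in
  particular against every static bond current (`tapPairing_bondCurrent_eq_zero`: the `s = 0` slice of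
  `P` is content-free for EVERY `u`, so `d = 0`, `N ≤ 2` and the phantom bond `i = N-1` carry no
  content); the backward flow `Φ_{-s} := Θ ∘ Φ_s ∘ Θ` is the two-sided inverse of `Φ_s`
  (`detFlow_flip_detFlow_flip`, `flip_detFlow_flip_detFlow`, from the time reversal
  `detFlow_reversal`); `tapPairing_detFlow_eq_neg_back` — **the pairing is ODD in time**:
  `⟨∂_b u⁺, ∂_b(j_i∘Φ_s)⟩ = -⟨∂_b u⁺, ∂_b(j_i∘Φ_{-s})⟩`, i.e. `P` only tests the time-antisymmetric
  part `(j_i∘Φ_s - j_i∘Φ_{-s})/2` of the closed-flow current, whose `p_b`-dependence at a bond at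
  distance `d ≥ 1` starts at order `s^{2d+1}` (locality of the Liouvillian).
-/

noncomputable section

namespace Summit.AtomisticToContinuum.FouriersLaw.Theorems.TapLeakBound.Negative.TimeParity

open MeasureTheory Filter Topology ProbabilityTheory Set
open scoped NNReal ENNReal
open Literature.MathematicalPhysics.KineticTheory.HeatConduction
open Summit.AtomisticToContinuum.FouriersLaw.Theses.OddSectorIrreversibility
open Summit.AtomisticToContinuum.FouriersLaw.Theorems.ClosedConeSensitivity.Negative.ZeroFrictionDictionary
open Summit.AtomisticToContinuum.FouriersLaw.Theorems.OddSectorWitness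

variable {ω₂ lam β : ℝ}

/-! ## Dictionary -/

/-- The kernel average of the crux is the closed-flow transported current `j_i (Φ_s x)` (`s ≥ 0`;
zero-friction kernel = Dirac mass at `detFlow`; the current does not depend on `γ`). [folklore] -/
theorem kernelCurrent_eq_comp_detFlow (hω : 0 < ω₂) (hl : 0 ≤ lam) (hβ : 0 ≤ β) (γ : ℝ) (N : ℕ) (i : Fin N)
    (T : ℝ) {s : ℝ} (hs : 0 ≤ s) (x : PhaseSpace N) :
    (∫ y, (pinnedChain ω₂ lam β γ).bondCurrent N i y ∂((pinnedChain ω₂ lam β 0).transitionKernel N T T s.toNNReal x)) =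
      (pinnedChain ω₂ lam β 0).bondCurrent N i (detFlow ω₂ lam β N s x) := by
  rw [integral_transitionKernel_zero_friction hω hl hβ]
  simp only [bondCurrent_indep_friction, Real.coe_toNNReal _ hs]

/-! ## Parity of the tap-leak pairing -/

/-- The even part `u⁺ = (u + u∘Θ)/2` is even. [folklore] -/
theorem evenPart_flip {N : ℕ} (u : PhaseSpace N → ℝ) (x : PhaseSpace N) :
    (fun y : PhaseSpace N => (u y + u (y.1, -y.2)) / 2) (x.1, -x.2) =
      (fun y : PhaseSpace N => (u y + u (y.1, -y.2)) / 2) x := by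
  simp only [neg_neg, Prod.mk.eta]
  ring

/-- `∂_{p_b} u⁺` is Θ-odd, for EVERY `u` (no differentiability needed). [folklore] -/
theorem partialP_evenPart_flip {N : ℕ} (u : PhaseSpace N → ℝ) (b : Fin N) (x : PhaseSpace N) :
    partialP b (fun y : PhaseSpace N => (u y + u (y.1, -y.2)) / 2) (x.1, -x.2) =
      -partialP b (fun y : PhaseSpace N => (u y + u (y.1, -y.2)) / 2) x := by
  have h := partialP_comp_momentumReversal N (fun y : PhaseSpace N => (u y + u (y.1, -y.2)) / 2) b x
  have hfun : (fun y : PhaseSpace N => (fun z : PhaseSpace N => (u z + u (z.1, -z.2)) / 2) (y.1, -y.2)) =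
      fun y : PhaseSpace N => (u y + u (y.1, -y.2)) / 2 := funext fun y => evenPart_flip u y
  rw [hfun] at h
  linarith

/-- `∂_{p_b}(-g) = -∂_{p_b} g` (no differentiability needed). [folklore] -/
theorem partialP_neg' {N : ℕ} (b : Fin N) (g : PhaseSpace N → ℝ) (x : PhaseSpace N) :
    partialP b (fun y => -g y) x = -partialP b g x := by
  unfold partialP
  exact deriv.neg

/-- **Parity of the tap-leak pairing.** For EVERY `u` and EVERY observable `g` (no regularity, no
integrability: a change of variables under the momentum reversal, which preserves the Gibbs weight,
and `∂_b(g∘Θ) = -(∂_b g)∘Θ`): `∫ ∂_b u⁺ · ∂_b g dμ_T = ∫ ∂_b u⁺ · ∂_b (g∘Θ) dμ_T`. In words: the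
pairing of `P` only sees the Θ-even part `(g + g∘Θ)/2` of the transported observable. [folklore] -/
theorem tapPairing_eq_tapPairing_flip (γ T : ℝ) (N : ℕ) (b : Fin N) (u g : PhaseSpace N → ℝ) :
    ∫ x, partialP b (fun y : PhaseSpace N => (u y + u (y.1, -y.2)) / 2) x * partialP b g x
        ∂(gibbsWeight ω₂ lam β γ N T) =
      ∫ x, partialP b (fun y : PhaseSpace N => (u y + u (y.1, -y.2)) / 2) x *
        partialP b (fun y : PhaseSpace N => g (y.1, -y.2)) x ∂(gibbsWeight ω₂ lam β γ N T) := by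
  rw [← integral_comp_momentumReversal_gibbsWeight (ω₂ := ω₂) (lam := lam) (β := β) γ N T
    (fun x => partialP b (fun y : PhaseSpace N => (u y + u (y.1, -y.2)) / 2) x * partialP b g x)]
  refine integral_congr_ae (Eventually.of_forall fun x => ?_)
  have h1 := partialP_evenPart_flip u b x
  have h2 := partialP_comp_momentumReversal N g b x
  simp only [h1, h2]
  ring

/-- **The pairing against a Θ-odd observable vanishes**, for EVERY `u`. [folklore] -/
theorem tapPairing_eq_zero_of_odd (γ T : ℝ) (N : ℕ) (b : Fin N) (u g : PhaseSpace N → ℝ)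
    (hodd : ∀ y, g (y.1, -y.2) = -g y) :
    ∫ x, partialP b (fun y : PhaseSpace N => (u y + u (y.1, -y.2)) / 2) x * partialP b g x
        ∂(gibbsWeight ω₂ lam β γ N T) = 0 := by
  set F : PhaseSpace N → ℝ := fun x =>
    partialP b (fun y : PhaseSpace N => (u y + u (y.1, -y.2)) / 2) x * partialP b g x with hF
  have hflip : ∀ x, F (x.1, -x.2) = -F x := fun x => by
    have h1 := partialP_evenPart_flip u b x
    have hg : partialP b g (x.1, -x.2) = partialP b g x := by
      have h3 := partialP_comp_momentumReversal N g b x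
      have hfun' : (fun y : PhaseSpace N => g (y.1, -y.2)) = fun y => -g y := funext hodd
      rw [hfun', partialP_neg'] at h3
      linarith
    simp only [hF, h1, hg]
    ring
  have hI := integral_comp_momentumReversal_gibbsWeight (ω₂ := ω₂) (lam := lam) (β := β) γ N T F
  simp only [hflip, integral_neg] at hI
  show ∫ x, F x ∂(gibbsWeight ω₂ lam β γ N T) = 0
  linarith

/-- **`s = 0`: the tap-leak pairing against the static current vanishes** for every `u`, every bond,
every contact, every `N` (`j_i` is odd in the momenta) — the `s = 0` slice of `P`, hence its `d = 0`
and `N ≤ 2` instances, are content-free. [folklore] -/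
theorem tapPairing_bondCurrent_eq_zero (γ γ' T : ℝ) (N : ℕ) (i b : Fin N) (u : PhaseSpace N → ℝ) :
    ∫ x, partialP b (fun y : PhaseSpace N => (u y + u (y.1, -y.2)) / 2) x *
        partialP b ((pinnedChain ω₂ lam β γ').bondCurrent N i) x ∂(gibbsWeight ω₂ lam β γ N T) = 0 :=
  tapPairing_eq_zero_of_odd γ T N b u _ fun y => OscillatorChain.bondCurrent_neg_momentum _ N i y

/-- The pairing is odd in its second slot (junk-free: `∂_b(-g) = -∂_b g`, `∫(-F) = -∫F`). [folklore] -/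
theorem tapPairing_neg (γ T : ℝ) (N : ℕ) (b : Fin N) (u g : PhaseSpace N → ℝ) :
    ∫ x, partialP b (fun y : PhaseSpace N => (u y + u (y.1, -y.2)) / 2) x * partialP b (fun y => -g y) x
        ∂(gibbsWeight ω₂ lam β γ N T) =
      -∫ x, partialP b (fun y : PhaseSpace N => (u y + u (y.1, -y.2)) / 2) x * partialP b g x
        ∂(gibbsWeight ω₂ lam β γ N T) := by
  rw [← integral_neg]
  refine integral_congr_ae (Eventually.of_forall fun x => ?_)
  simp only [partialP_neg']
  ring

/-! ## The backward flow and time-antisymmetry -/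

section Back

variable (hω : 0 < ω₂) (hl : 0 ≤ lam) (hβ : 0 ≤ β)
include hω hl hβ

/-- **`Φ_s ∘ Φ_{-s} = id`** with the backward flow `Φ_{-s} x := Θ (Φ_s (Θ x))` (`s ≥ 0`; time
reversal of the Hamiltonian flow). [cite: Arnold1989, §8 (reversibility)] -/
theorem detFlow_flip_detFlow_flip (N : ℕ) {s : ℝ} (hs : 0 ≤ s) (x : PhaseSpace N) :
    detFlow ω₂ lam β N s
        ((detFlow ω₂ lam β N s (x.1, -x.2)).1, -(detFlow ω₂ lam β N s (x.1, -x.2)).2) = x := by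
  have h := Summit.AtomisticToContinuum.FouriersLaw.Theorems.OddSectorIrreversibility.Corrector.detFlow_reversal
    hω hl hβ N ((x.1, -x.2) : PhaseSpace N) hs
  simpa using h

/-- **`Φ_{-s} ∘ Φ_s = id`** (`s ≥ 0`). [cite: Arnold1989, §8 (reversibility)] -/
theorem flip_detFlow_flip_detFlow (N : ℕ) {s : ℝ} (hs : 0 ≤ s) (x : PhaseSpace N) :
    (((detFlow ω₂ lam β N s ((detFlow ω₂ lam β N s x).1, -(detFlow ω₂ lam β N s x).2)).1,
      -(detFlow ω₂ lam β N s ((detFlow ω₂ lam β N s x).1, -(detFlow ω₂ lam β N s x).2)).2) : PhaseSpace N) = x := by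
  have h := Summit.AtomisticToContinuum.FouriersLaw.Theorems.OddSectorIrreversibility.Corrector.detFlow_reversal
    hω hl hβ N x hs
  rw [h]
  simp

end Back

/-- `(j_i∘Φ_s)(Θx) = -(j_i∘Φ_{-s})(x)` with `Φ_{-s} = Θ ∘ Φ_s ∘ Θ` (`j_i` odd in the momenta). [folklore] -/
theorem bondCurrent_detFlow_flip (P : OscillatorChain) (N : ℕ) (i : Fin N) (s : ℝ) (x : PhaseSpace N) :
    P.bondCurrent N i (detFlow ω₂ lam β N s (x.1, -x.2)) =
      -P.bondCurrent N i ((detFlow ω₂ lam β N s (x.1, -x.2)).1, -(detFlow ω₂ lam β N s (x.1, -x.2)).2) := by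
  rw [OscillatorChain.bondCurrent_neg_momentum, neg_neg]

/-- **The tap-leak pairing is odd in time**: for every `u`, every `s`, every bond and contact,
`∫ ∂_b u⁺ · ∂_b (j_i∘Φ_s) dμ_T = -∫ ∂_b u⁺ · ∂_b (j_i∘Φ_{-s}) dμ_T` with the backward flow
`Φ_{-s} = Θ ∘ Φ_s ∘ Θ` (junk-free). So `P` only tests the time-antisymmetric part
`(j_i∘Φ_s - j_i∘Φ_{-s})/2` of the closed-flow current. [folklore] -/
theorem tapPairing_detFlow_eq_neg_back (P : OscillatorChain) (γ T : ℝ) (N : ℕ) (i b : Fin N)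
    (u : PhaseSpace N → ℝ) (s : ℝ) :
    ∫ x, partialP b (fun y : PhaseSpace N => (u y + u (y.1, -y.2)) / 2) x *
        partialP b (fun y : PhaseSpace N => P.bondCurrent N i (detFlow ω₂ lam β N s y)) x
        ∂(gibbsWeight ω₂ lam β γ N T) =
      -∫ x, partialP b (fun y : PhaseSpace N => (u y + u (y.1, -y.2)) / 2) x *
        partialP b (fun y : PhaseSpace N => P.bondCurrent N i
          ((detFlow ω₂ lam β N s (y.1, -y.2)).1, -(detFlow ω₂ lam β N s (y.1, -y.2)).2)) x
        ∂(gibbsWeight ω₂ lam β γ N T) := by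
  rw [tapPairing_eq_tapPairing_flip]
  have hfun : (fun y : PhaseSpace N => (fun z : PhaseSpace N => P.bondCurrent N i (detFlow ω₂ lam β N s z)) (y.1, -y.2)) =
      fun y : PhaseSpace N => -P.bondCurrent N i
        ((detFlow ω₂ lam β N s (y.1, -y.2)).1, -(detFlow ω₂ lam β N s (y.1, -y.2)).2) :=
    funext fun y => bondCurrent_detFlow_flip P N i s y
  rw [hfun, tapPairing_neg]

end Summit.AtomisticToContinuum.FouriersLaw.Theorems.TapLeakBound.Negative.TimeParity

end
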